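import Literature.Analysis.FluidPDE.NormalisedPressureCompactSupport
import Literature.Analysis.FluidPDE.NormalisedPressureSmooth
import Literature.Analysis.FluidPDE.NormalisedPressureLpBoundProofs
import Literature.Analysis.FluidPDE.LerayProfileCalculus
import Literature.Analysis.FluidPDE.TaoEnergyLocalisation
import HarnessLib

/-!
# Steady Navier–Stokes: splitting the pressure into a Riesz part and a harmonic part

Analysis/FluidPDE proof file (everything PROVED; no definitions, no named facts) on the
discharge path of the named fact `Literature.Analysis.FluidPDE.sereginWang_liouville_L3_annulus`
(Seregin–Wang 2020, Thm 1.1 (i), `q = ℓ = 3`).  The printed proof of the Caccioppoli-type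
inequality (ibid., Prop. 2.1) removes the pressure with a Bogovskiĭ corrector; the tree has no
Bogovskiĭ operator, and the discharge estimates the pressure term `∫ p (Dφ·u)` of the localised
energy identity (`SteadyNSLocalEnergy`) directly, through the classical splitting of the
pressure near the annulus `A_R = {R/2 ≤ |x| < R}` where `Dφ` lives (local pressure
decompositions of this kind: Tsai 2021, §2; Wang 2025, §2.3):

  `p = p̃[χ u] + h`,  `p̃[w] = -Δ⁻¹∂ᵢ∂ⱼ(wᵢwⱼ)`,  `Δh = 0` wherever `χ = 1` (locally),

with `χ` a smooth compactly supported cut-off.  Here `p̃` is the tree's normalised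
(Riesz-transform) pressure `normalisedPressure` (`NormalisedPressure.lean`), which for `C_c^∞`
fields is smooth (`NormalisedPressureSmooth`), satisfies `Δp̃[w] = -∂ᵢ∂ⱼ(wᵢwⱼ)`
(`NormalisedPressureCompactSupport`) and Stein's bound `‖p̃[w]‖_{3/2} ≤ C ‖|w|²‖_{3/2}` (PROVED
in the tree: `stein1970_normalisedPressure_Lp_bound_holds`, Calderón–Zygmund theory).

* `exists_swAnnulusCutoff` — a smooth cut-off `χ_R` of the annulus: values in `[0, 1]`, `= 1`
  on `{5R/8 ≤ |x| ≤ 31R/32}`, `tsupport χ_R ⊆ {17R/32 ≤ |x| ≤ 63R/64} ⊆ A_R` (built from the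
  tree's `taoCutoff`; an existence THEOREM, so that downstream statements quantify over an
  arbitrary cut-off with these properties);
* the localised velocity `χ u`: `C_c^∞`, `|χ u| ≤ |u|`, `‖χ u‖_{L^q} ≤ ‖u‖_{L^q(A)}` when
  `tsupport χ ⊆ A` and `|χ| ≤ 1`;
* `pressureSource_congr_of_isOpen` — locality of the quadratic source `∂ᵢ∂ⱼ(vᵢvⱼ)`;
* `laplacian_pressure_sub_normalisedPressure_eq_zero` — **the harmonic part**: for a smooth
  steady solution (`IsLerayProfile 1 0 u p`, `u`, `p` smooth) and an open set `U` on which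
  `χ = 1`, `h = p − p̃[χ u]` has `Δh = 0` on `U` (pressure Poisson equation `Δp = -tr(Du Du)` of
  the profile, `IsLerayProfile.laplacian_pressure_eq`, against
  `Δp̃[χ u] = -∂ᵢ∂ⱼ(uᵢuⱼ) = -div((u·∇)u) = -tr(Du Du)` on `U`, by locality and `div u = 0`);
* `exists_stein_threeHalves` — Stein's constant at exponent `3/2` in the form used downstream:
  `‖p̃[w]‖_{3/2} ≤ C ‖w‖²_{3}` for all `w ∈ C_c^∞` (with `‖|w|²‖_{3/2} = ‖w‖²_3` derived inline,
  cf. the tree's `eLpNorm_norm_sq_eq_threeHalves`).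

## References

* G. Seregin, W. Wang, St. Petersburg Math. J. 31 (2020) = arXiv:1805.02227, Prop. 2.1.
  [`SereginWang2020`]
* E. M. Stein, *Singular integrals and differentiability properties of functions* (1970),
  Ch. II §4.2 Thm 3. [`Stein1971`]
* T.-P. Tsai, *Liouville type theorems for stationary Navier–Stokes equations*, SN PDE 2 (2021),
  §2 (local pressure representation on annuli). [`Tsai2021`]
-/

noncomputable section

open MeasureTheory Set Filter Topology InnerProductSpace Function Metric
open scoped RealInnerProductSpace Laplacian ENNReal NNReal ContDiff

namespace Literature.Analysis.FluidPDE

/-! ### An annular cut-off -/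

section Cutoff

variable {E : Type*} [NormedAddCommGroup E]

/-- The profile `Θ = θ_{63/64,1/64} · (1 − θ_{5/8,3/32})` (`θ = taoCutoff`) takes values in
`[0, 1]`. [folklore] -/
theorem swProfile_mem_Icc (x : E) :
    taoCutoff (63 / 64) (1 / 64) x * (1 - taoCutoff (5 / 8) (3 / 32) x) ∈ Icc (0 : ℝ) 1 :=
  ⟨mul_nonneg (taoCutoff_nonneg _ _ _) (sub_nonneg.2 (taoCutoff_le_one _ _ _)),
    mul_le_one₀ (taoCutoff_le_one _ _ _) (sub_nonneg.2 (taoCutoff_le_one _ _ _))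
      (sub_le_self _ (taoCutoff_nonneg _ _ _))⟩

/-- `Θ = 1` on `{5/8 ≤ |x| ≤ 31/32}`. [folklore] -/
theorem swProfile_eq_one {x : E} (h1 : 5 / 8 ≤ ‖x‖) (h2 : ‖x‖ ≤ 31 / 32) :
    taoCutoff (63 / 64) (1 / 64) x * (1 - taoCutoff (5 / 8) (3 / 32) x) = 1 := by
  rw [taoCutoff_eq_one_of_norm_le (by norm_num) (by norm_num) (by norm_num)
    (by norm_num; exact h2), taoCutoff_eq_zero (by norm_num) (by norm_num) h1]
  norm_num

/-- `Θ = 0` on `{|x| ≤ 17/32}`. [folklore] -/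
theorem swProfile_eq_zero_of_le {x : E} (h : ‖x‖ ≤ 17 / 32) :
    taoCutoff (63 / 64) (1 / 64) x * (1 - taoCutoff (5 / 8) (3 / 32) x) = 0 := by
  rw [taoCutoff_eq_one_of_norm_le (R := 5 / 8) (by norm_num) (by norm_num)
    (by norm_num) (by norm_num; exact h)]
  norm_num

/-- `Θ = 0` on `{|x| ≥ 63/64}`. [folklore] -/
theorem swProfile_eq_zero_of_ge {x : E} (h : 63 / 64 ≤ ‖x‖) :
    taoCutoff (63 / 64) (1 / 64) x * (1 - taoCutoff (5 / 8) (3 / 32) x) = 0 := by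
  rw [taoCutoff_eq_zero (by norm_num) (by norm_num) h, zero_mul]

variable [InnerProductSpace ℝ E] [FiniteDimensional ℝ E]

/-- **An annular cut-off at scale `R > 0`.**  There is `χ ∈ C_c^∞(E)` with `0 ≤ χ ≤ 1`, `χ = 1`
on the closed shell `{5R/8 ≤ |x| ≤ 31R/32}`, and `tsupport χ ⊆ {17R/32 ≤ |x| ≤ 63R/64}` (hence
`⊆ A_R = {R/2 ≤ |x| < R}`), namely `χ(x) = Θ(R⁻¹ x)`. [folklore] -/
theorem exists_swAnnulusCutoff {R : ℝ} (hR : 0 < R) :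
    ∃ χ : E → ℝ, ContDiff ℝ ∞ χ ∧ HasCompactSupport χ ∧ (∀ x, 0 ≤ χ x ∧ χ x ≤ 1) ∧
      (∀ x, 5 * R / 8 ≤ ‖x‖ → ‖x‖ ≤ 31 * R / 32 → χ x = 1) ∧
      tsupport χ ⊆ {x : E | 17 * R / 32 ≤ ‖x‖ ∧ ‖x‖ ≤ 63 * R / 64} := by
  set χ : E → ℝ := fun x =>
    taoCutoff (63 / 64) (1 / 64) (R⁻¹ • x) * (1 - taoCutoff (5 / 8) (3 / 32) (R⁻¹ • x)) with hχ
  have hnorm : ∀ x : E, ‖R⁻¹ • x‖ = ‖x‖ / R := fun x => by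
    rw [norm_smul, norm_inv, Real.norm_eq_abs, abs_of_pos hR, div_eq_inv_mul]
  have hsmooth : ContDiff ℝ ∞ χ :=
    ((contDiff_taoCutoff _ _).mul (contDiff_const.sub (contDiff_taoCutoff _ _))).comp
      (contDiff_const_smul _)
  have hzero_le : ∀ x : E, ‖x‖ ≤ 17 * R / 32 → χ x = 0 := fun x hx => by
    refine swProfile_eq_zero_of_le ?_
    rw [hnorm, div_le_iff₀ hR]; linarith
  have hzero_ge : ∀ x : E, 63 * R / 64 ≤ ‖x‖ → χ x = 0 := fun x hx => by
    refine swProfile_eq_zero_of_ge ?_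
    rw [hnorm, le_div_iff₀ hR]; linarith
  have hsupp : support χ ⊆ {x : E | 17 * R / 32 < ‖x‖ ∧ ‖x‖ < 63 * R / 64} := by
    intro x hx
    rw [mem_support] at hx
    constructor
    · by_contra h; exact hx (hzero_le x (not_lt.1 h))
    · by_contra h; exact hx (hzero_ge x (not_lt.1 h))
  have htsupp : tsupport χ ⊆ {x : E | 17 * R / 32 ≤ ‖x‖ ∧ ‖x‖ ≤ 63 * R / 64} := by
    have hcl : IsClosed {x : E | 17 * R / 32 ≤ ‖x‖ ∧ ‖x‖ ≤ 63 * R / 64} :=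
      (isClosed_le continuous_const continuous_norm).inter
        (isClosed_le continuous_norm continuous_const)
    exact closure_minimal (hsupp.trans fun y hy => ⟨le_of_lt hy.1, le_of_lt hy.2⟩) hcl
  refine ⟨χ, hsmooth, ?_, fun x => swProfile_mem_Icc _, fun x h1 h2 => ?_, htsupp⟩
  · exact HasCompactSupport.of_support_subset_isCompact (isCompact_closedBall (0 : E) R)
      (hsupp.trans fun x hx => mem_closedBall_zero_iff.2 (by linarith [hx.2]))
  · refine swProfile_eq_one ?_ ?_
    · rw [hnorm, le_div_iff₀ hR]; linarith
    · rw [hnorm, div_le_iff₀ hR]; linarith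

end Cutoff

/-! ### The localised velocity `χ u` -/

section Localised

variable {E : Type*} [NormedAddCommGroup E] [InnerProductSpace ℝ E]
variable {χ : E → ℝ} {u : E → E}

/-- `|χ u| ≤ |u|` when `|χ| ≤ 1`. [folklore] -/
theorem norm_cutoff_smul_le_of_unit (hχ : ∀ x, 0 ≤ χ x ∧ χ x ≤ 1) (u : E → E) (x : E) :
    ‖χ x • u x‖ ≤ ‖u x‖ := by
  rw [norm_smul, Real.norm_eq_abs, abs_of_nonneg (hχ x).1]
  exact mul_le_of_le_one_left (norm_nonneg _) (hχ x).2

/-- `χ u` agrees with `u` near every point of an open set on which `χ = 1`. [folklore] -/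
theorem cutoff_smul_eventuallyEq {U : Set E} (hU : IsOpen U) (hχ1 : ∀ y ∈ U, χ y = 1) {x : E}
    (hx : x ∈ U) : (fun y => χ y • u y) =ᶠ[𝓝 x] u := by
  filter_upwards [hU.mem_nhds hx] with y hy
  rw [hχ1 y hy, one_smul]

variable [FiniteDimensional ℝ E] [MeasurableSpace E] [BorelSpace E]

/-- **`‖χ u‖_{L^q(E)} ≤ ‖u‖_{L^q(A)}`** when `tsupport χ ⊆ A` and `0 ≤ χ ≤ 1`. [folklore] -/
theorem eLpNorm_cutoff_smul_le (hχ : ∀ x, 0 ≤ χ x ∧ χ x ≤ 1) {A : Set E} (hA : tsupport χ ⊆ A)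
    (u : E → E) (q : ℝ≥0∞) :
    eLpNorm (fun x => χ x • u x) q volume ≤ eLpNorm u q (volume.restrict A) := by
  rw [← eLpNorm_restrict_eq_of_support_subset (μ := volume) (s := A)
    (f := fun x => χ x • u x) ?_]
  · exact eLpNorm_mono fun x => norm_cutoff_smul_le_of_unit hχ u x
  · intro x hx
    refine hA (subset_tsupport _ ?_)
    rw [mem_support] at hx ⊢
    contrapose! hx
    rw [hx, zero_smul]

end Localised

/-! ### Locality of the quadratic source and the harmonic part of the pressure -/

section Harmonic

variable {E : Type*} [NormedAddCommGroup E] [InnerProductSpace ℝ E]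

/-- **Locality of the source `∂ᵢ∂ⱼ(vᵢvⱼ)`**: if `w = v` on an open set `U`, then
`pressureSource w = pressureSource v` on `U` (a differential operator). [folklore] -/
theorem pressureSource_congr_of_isOpen {w v : E → E} {U : Set E} (hU : IsOpen U) (heq : ∀ y ∈ U, w y = v y)
    {x : E} (hx : x ∈ U) : pressureSource w x = pressureSource v x := by
  have hev : ∀ y ∈ U, w =ᶠ[𝓝 y] v := fun y hy => by
    filter_upwards [hU.mem_nhds hy] with z hz using heq z hz
  have hG : (fun y => FluidPDE.convect w w y + VectorCalculus.divergence w y • w y) =ᶠ[𝓝 x]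
      fun y => FluidPDE.convect v v y + VectorCalculus.divergence v y • v y := by
    filter_upwards [hU.mem_nhds hx] with y hy
    have hD : fderiv ℝ w y = fderiv ℝ v y := (hev y hy).fderiv_eq
    simp only [FluidPDE.convect, VectorCalculus.divergence, hD, heq y hy]
  rw [pressureSource_def, pressureSource_def, VectorCalculus.divergence, VectorCalculus.divergence,
    hG.fderiv_eq]

/-- **The harmonic part of the pressure.**  Let `(u, p)` be a smooth solution of the steady
Navier–Stokes system on `ℝ³` (`IsLerayProfile 1 0 u p`, `u`, `p` smooth), `χ ∈ C_c^∞` and `U`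
an open set on which `χ = 1`.  Then `h = p − p̃[χ u]` satisfies `Δh = 0` on `U`:
`Δp = -tr(Du ∘ Du)` (`IsLerayProfile.laplacian_pressure_eq`) and
`Δp̃[χ u] = -∂ᵢ∂ⱼ((χu)ᵢ(χu)ⱼ) = -∂ᵢ∂ⱼ(uᵢuⱼ) = -div((u·∇)u) = -tr(Du ∘ Du)` on `U`
(`laplacian_normalisedPressure_of_hasCompactSupport`, locality, `div u = 0`). [folklore] -/
theorem laplacian_pressure_sub_normalisedPressure_eq_zero
    {u : EuclideanSpace ℝ (Fin 3) → EuclideanSpace ℝ (Fin 3)} {p : EuclideanSpace ℝ (Fin 3) → ℝ}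
    (hprof : IsLerayProfile 1 0 u p) (hu : ContDiff ℝ ∞ u) (hp : ContDiff ℝ ∞ p)
    {χ : EuclideanSpace ℝ (Fin 3) → ℝ} (hχ : ContDiff ℝ ∞ χ) (hχc : HasCompactSupport χ)
    {U : Set (EuclideanSpace ℝ (Fin 3))} (hU : IsOpen U) (hχ1 : ∀ y ∈ U, χ y = 1)
    {x : EuclideanSpace ℝ (Fin 3)} (hx : x ∈ U) :
    (Δ (fun y => p y - normalisedPressure (fun z => χ z • u z) y)) x = 0 := by
  set w : EuclideanSpace ℝ (Fin 3) → EuclideanSpace ℝ (Fin 3) := fun z => χ z • u z with hw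
  have hwinf : ContDiff ℝ ∞ w := hχ.smul hu
  have hwc : HasCompactSupport w := hχc.smul_right
  have hp2 : ContDiff ℝ 2 p := contDiff_infty.1 hp 2
  have hu3 : ContDiff ℝ 3 u := contDiff_infty.1 hu 3
  have hu2 : ContDiff ℝ 2 u := contDiff_infty.1 hu 2
  have hq2 : ContDiff ℝ 2 (normalisedPressure w) :=
    contDiff_normalisedPressure_of_hasCompactSupport hwinf hwc
  have hsub : (Δ (fun y => p y - normalisedPressure w y)) x =
      (Δ p) x - (Δ (normalisedPressure w)) x := by
    rw [← ContDiffAt.laplacian_sub hp2.contDiffAt hq2.contDiffAt]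
    rfl
  have hwU : ∀ y ∈ U, w y = u y := fun y hy => by rw [hw]; simp [hχ1 y hy]
  rw [hsub, hprof.laplacian_pressure_eq hu3 hp2, laplacian_normalisedPressure_of_hasCompactSupport
    hwinf hwc x, pressureSource_congr_of_isOpen hU hwU hx, pressureSource_eq_of_isDivFree hprof.divFree,
    divergence_convect_self_eq hu2 hprof.divFree]
  ring

/-- `h = p − p̃[χ u]` is smooth on `ℝ³` when `u`, `p` are and `χ ∈ C_c^∞`. [folklore] -/
theorem contDiff_pressure_sub_normalisedPressure
    {u : EuclideanSpace ℝ (Fin 3) → EuclideanSpace ℝ (Fin 3)} {p : EuclideanSpace ℝ (Fin 3) → ℝ}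
    (hu : ContDiff ℝ ∞ u) (hp : ContDiff ℝ ∞ p) {χ : EuclideanSpace ℝ (Fin 3) → ℝ}
    (hχ : ContDiff ℝ ∞ χ) (hχc : HasCompactSupport χ) :
    ContDiff ℝ ∞ (fun y => p y - normalisedPressure (fun z => χ z • u z) y) :=
  hp.sub (contDiff_normalisedPressure_of_contDiff_infty (hχ.smul hu) hχc.smul_right)

end Harmonic

/-! ### Stein's bound at exponent `3/2` -/

section Stein

/-- **Stein's bound at exponent `3/2`** in the form used downstream: one constant `C` with
`‖p̃[w]‖_{L^{3/2}} ≤ C ‖w‖²_{L³}` for every `w ∈ C_c^∞(ℝ³; ℝ³)` (the tree's PROVED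
`stein1970_normalisedPressure_Lp_bound_holds`, Stein 1970, Ch. II §4.2 Thm 3, with
`‖|w|²‖_{3/2} = ‖w‖²_3`). [cite: Stein1971, Ch. II §4.2 Thm 3] -/
theorem exists_stein_threeHalves :
    ∃ C : ℝ≥0, ∀ w : EuclideanSpace ℝ (Fin 3) → EuclideanSpace ℝ (Fin 3), ContDiff ℝ ∞ w →
      HasCompactSupport w →
        eLpNorm (normalisedPressure w) (3 / 2) volume ≤ C * eLpNorm w 3 volume ^ 2 := by
  have h1 : (1 : ℝ≥0∞) < 3 / 2 := by
    rw [ENNReal.lt_div_iff_mul_lt (Or.inl (by norm_num)) (Or.inl (by norm_num))]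
    norm_num
  have h2 : (3 / 2 : ℝ≥0∞) < ⊤ := ENNReal.div_lt_top (by norm_num) (by norm_num)
  obtain ⟨C, hC⟩ := stein1970_normalisedPressure_Lp_bound_holds (3 / 2) h1 h2
  refine ⟨C, fun w hw hwc => ?_⟩
  -- `‖|w|²‖_{3/2} = ‖w‖²_3` (as in the tree's `eLpNorm_norm_sq_eq_threeHalves` of
  -- `WholeSpacePressureL3`, not imported to keep the closure small)
  have hsq : eLpNorm (fun x => ‖w x‖ ^ 2) (3 / 2) volume = eLpNorm w 3 volume ^ 2 := by
    have h := eLpNorm_norm_rpow w (p := (3 / 2 : ℝ≥0∞)) (μ := volume) (q := 2) two_pos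
    have e1 : (fun x => ‖w x‖ ^ (2 : ℝ)) = fun x => ‖w x‖ ^ 2 := by
      funext x; exact Real.rpow_two _
    have e2 : (3 / 2 : ℝ≥0∞) * ENNReal.ofReal 2 = 3 := by
      rw [ENNReal.ofReal_ofNat, ENNReal.div_mul_cancel (by norm_num) (by norm_num)]
    rw [e1, e2] at h
    rw [h]
    norm_cast
  rw [← hsq]
  exact hC w hw hwc

end Stein

end Literature.Analysis.FluidPDE

end
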